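import Literature.NumberTheory.EllipticCurves.Rank1Residual.Typed.PAdicCertificateMultiplicativeExists
import Literature.NumberTheory.EllipticCurves.Rank1Residual.Typed.X11Three
import HarnessLib

/-!
# X11 ∧ `r = 1` ∧ `p = 3`: the per-pair `3`-adic certificate theorems in their census shape (`Surj W 3`, datum-free, no leading-term hypothesis), and the typed input discharged per pair (cell `b2b-bsdres`)

HONEST FRAMING (run/shared/lean/b2b/bsd-rank1-residual/, verbatim): the goal of the cell is to
DELETE the COMBINATION-SHAPED residual classes for ALL analytic-rank `≤ 1` elliptic curves over `ℚ`
— "full BSD formula for every rank `≤ 1` curve in class C" assembled STRICTLY from published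
theorems — so that the rank-`≤ 1` remainder becomes exactly the CONSTRUCTION-SHAPED classes, which
are TYPED (missing-input `Prop`s), NOT attempted. This is not "finishing BSD". The CLASS
X11 ∧ `r = 1` ∧ `p = 3` (`X11Three`) is CONSTRUCTION-SHAPED (REFEREE R6.2) and STAYS so: this file
is a per-curve certificate lever and per-pair bookkeeping; no class theorem; no verdict or label
changed (the lane certifies).

Theorems only (no definition, no new named fact; prover x11b gen 5). The tree already holds, for
ANY odd `p` with `p`-ADICALLY surjective image (`hρ : ∀ n, ρ̄_{E,p^n}` onto), the datum-free,
leading-term-free certificate theorems `X11.bsdp_of_katoSurj_{split,nonsplit}_of_surjective_pow_of_certificate`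
(`Typed/PAdicCertificateMultiplicativeExists.lean`, literature seat gen 6, p182077: Kato's
divisibility via Wuthrich 2014 Thm. 3 / Cor. 19 `hK`, Stein–Wuthrich 2013 Thm. 6.1 `hJ` for the
leading term, SW §4.2 height existence `hH`, Wuthrich Prop. 21 `hW`, GZK, modularity, BDGP `h𝓛`),
and, with the OLD leading-term hypothesis `hLT`, the `p = 3` wrappers
`X11.bsdp_of_katoSurj_{split,nonsplit}_three` (`Typed/PAdicCertificateSurjectiveThree.lean`, p181489)
taking the CENSUS bit `Surj W 3` (mod `3`) through Wuthrich's Lemma 20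
(`surjective_pow_three_of_mult`: at a multiplicative prime `3`, mod-`3` surjective ⇒ `3`-adically
surjective). This file composes the two, giving the exact per-pair shape of the 111 rank-one
X11 ∧ `p = 3` census pairs (all 111 have `surj(3)`; 75 split, 36 non-split at `3`;
`b2b-bsdres-x11b/x11b_p3_r1_pairs.tsv`, `aprime_side_conditions_j039928.tsv`):

* `X11Three.bsdp_of_katoSurj_split_of_certificate`, `X11Three.bsdp_of_katoSurj_nonsplit_of_certificate`
  — inputs: PUBLISHED named facts (`hK`, `hJ`, `hH`, `h20`, `hW`, `hGZK`, `hmod`, `h𝓛`), the class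
  predicate `ClassX11 W 3`, the census bit `Surj W 3`, `ord_{s=1} L(E,s) ≤ 1`, the bookkeeping data
  of the divisibility fact (`κ, γ, f, D, ϖ, L`, Tate parameter), and the per-curve COMPUTED claims
  `hordL` (`ord_{T=0} L_3(E,T) = r + 1` split / `= r` non-split), `hcert` (valuation of the
  normalised leading coefficient = valuation of `𝓛_3 · ∏ c_v · Reg_3` resp. `2 · ∏ c_v · Reg_3`,
  for THE Stein–Wuthrich height — one number per curve by uniqueness) and `3 ∤ #Ш_an` (`hs`, `hv`).
* `X11Three.missingInputAt_of_bsdp` — per-pair bookkeeping: wherever `BSD(E,3)` is obtained (by the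
  theorems above, by the exact-`3`-descent route `X11.bsdp_of_shaAn_unit_of_noPTorsion` of
  `Typed/KolyvaginCertificate.lean`, or by Miller's `N < 5000` theorem), the CLASS's typed missing
  input `X11Three.MissingInputAt W` (R6.2, `Typed/X11Three.lean`) HOLDS at that pair — the typed
  `Prop` keeps describing the class; its census population below `10⁴` has no uncertified member
  (gen 4: exact `3`-descent 111/111; gen 5: `3`-adic certificates, `b2b-bsdres-x11b/p3cert/`).

SW13 Thm. 6.1 is printed for `p > 2`; Wuthrich 2014 Thm. 3 / Cor. 19 / Prop. 21 for odd `p`;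
Lemma 20 is the `p = 3` device. Per curve; NOT a deletion of X11 ∧ `r = 1` ∧ `p = 3`.

References: [SteinWuthrich2013] Thm. 6.1 (p. 1776), §4.2 (pp. 1771–1772); [Wuthrich2014] Thm. 3
(p. 382), Cor. 19 (p. 394), Lemma 20 and Prop. 21 (p. 400); [Miller2011LMS] Def. 1.1, Prop. 7.6;
cell files `Typed/PAdicCertificateMultiplicativeExists.lean`, `Typed/PAdicCertificateSurjectiveThree.lean`,
`Typed/X11Three.lean`, `b2b-bsdres-x11b/X11B-AUDIT.md` §14.
-/

set_option autoImplicit false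

noncomputable section

open scoped Classical MatrixGroups ModularForm

open CongruenceSubgroup WeierstrassCurve Literature.NumberTheory.EllipticCurves
  Literature.NumberTheory.EllipticCurves.ModularForms
  Literature.NumberTheory.EllipticCurves.Rank1Residual
  Literature.NumberTheory.EllipticCurves.Wuthrich2014
  Literature.NumberTheory.EllipticCurves.SteinWuthrich2013

namespace Literature.NumberTheory.EllipticCurves.Rank1Residual.Typed

/-! ### The census shape at `p = 3`: `Surj W 3` + class predicate + published facts + computed claims -/

/-- **X11 at `p = 3`, SPLIT multiplicative, `ρ̄_{E,3}` surjective, analytic rank `≤ 1`,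
`3 ∤ #Ш_an`: `BSD(E,3)`** from PUBLISHED facts (Kato–Wuthrich divisibility `hK`, Stein–Wuthrich
Thm. 6.1 `hJ`, SW §4.2 height existence `hH`, Lemma 20 `h20`, Prop. 21 `hW`, GZK, modularity, BDGP
`h𝓛`) plus the per-curve COMPUTED claims `hordL`, `hcert` (for THE Stein–Wuthrich height), `hs`/`hv`.
`X11.bsdp_of_katoSurj_split_of_surjective_pow_of_certificate` at `p = 3` with the `3`-adic
surjectivity supplied by `surjective_pow_three_of_mult`. Per curve; X11 ∧ `r = 1` ∧ `p = 3` stays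
CONSTRUCTION-SHAPED. [cite: SteinWuthrich2013, Thm. 6.1 (p. 1776) and §4.2]
[cite: Wuthrich2014, Thm. 3 (p. 382), Cor. 19 (p. 394), Lemma 20 (p. 400), Prop. 21 (p. 400)]
[cite: Miller2011LMS, Prop. 7.6] -/
theorem X11Three.bsdp_of_katoSurj_split_of_certificate
    (hK : kato_charIdeal_dvd_multiplicative_of_surjective) (hJ : thm61_splitMultiplicative)
    (hH : exists_isSplitMultCanonical) (h20 : lemma20_surjective_threeAdic_of_semistable)
    (hW : Wuthrich2014.sha_dvd_analyticSha)
    (hGZK : rank_eq_analyticRank_of_analyticRank_le_one) (hmod : hasEntireLFunction_rat)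
    (W : WeierstrassCurve ℚ) [W.IsElliptic] [W.IsGloballyMinimal] [Fact (3 : ℕ).Prime]
    (h𝓛 : LInvariant_ne_zero (W := W) (p := 3))
    {κ : ZpExtension ℚ 3} {γ : Field.absoluteGaloisGroup ℚ} {N : ℕ} [NeZero N]
    {f : CuspForm (Gamma0 N) 2} (hr : W.analyticRank ≤ 1) (hX : ClassX11 W 3) (hρ : Surj W 3)
    (Dq : TateParameterData W 3)
    (hκ : κ.IsCyclotomic) (hγ : κ.IsTopGenerator γ) (hγ' : IsCyclotomicVariable 3 γ)
    (hf : IsNewformOf W f) (D : W.SelmerDualData κ γ) (ϖ : ℚ) (hϖ0 : ϖ ≠ 0)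
    (hϖ : (ϖ : ℝ) * W.realPeriodRat = plusPeriod f)
    (L : PowerSeries ℚ_[3]) (hL : IsSplitMultPAdicLFunctionOf f 3 L)
    (hordL : L.order = (W.mordellWeilRank + 1 : ℕ))
    (hcert : ∀ Dh : PAdicHeightData W 3, IsSplitMultCanonical Dh Dq →
      (((ϖ : ℚ) : ℚ_[3]) * PowerSeries.coeff (W.mordellWeilRank + 1) L *
          (padicLog 3 (cyclotomicGenerator 3) ^ (W.mordellWeilRank + 1) *
            (W.torsionOrder : ℚ_[3]) ^ 2)).valuation =
        (LInvariant Dq * (W.tamagawaProduct : ℚ_[3]) * padicRegulator Dh).valuation)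
    {s : ℚ} (hs : shaAn W = (s : ℂ)) (hv : padicValRat 3 s = 0) : BSDp W 3 :=
  X11.bsdp_of_katoSurj_split_of_surjective_pow_of_certificate hK hJ hH hW hGZK hmod W 3 h𝓛
    (by decide) hr hX (surjective_pow_three_of_mult h20 W hX.1 hρ) Dq hκ hγ hγ' hf D ϖ hϖ0 hϖ L hL
    hordL hcert hs hv

/-- **X11 at `p = 3`, NON-split multiplicative, `ρ̄_{E,3}` surjective, analytic rank `≤ 1`,
`3 ∤ #Ш_an`: `BSD(E,3)`** as above from the non-split clause (`A = 2 · ∏ c_v`,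
`B = log_3(γ_cyc)^r · #E(ℚ)_tors²`, SW formula (4.1) height; existence `hH`).
`X11.bsdp_of_katoSurj_nonsplit_of_surjective_pow_of_certificate` at `p = 3` ∘
`surjective_pow_three_of_mult`. Per curve; no label change.
[cite: SteinWuthrich2013, Thm. 6.1 (p. 1776), §3.1 and §4.2]
[cite: Wuthrich2014, Thm. 3 (p. 382), Lemma 20 (p. 400), Prop. 21 (p. 400)]
[cite: Miller2011LMS, Prop. 7.6] -/
theorem X11Three.bsdp_of_katoSurj_nonsplit_of_certificate
    (hK : kato_charIdeal_dvd_multiplicative_of_surjective) (hJ : thm61_nonsplitMultiplicative)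
    (hH : exists_isMultCanonical) (h20 : lemma20_surjective_threeAdic_of_semistable)
    (hW : Wuthrich2014.sha_dvd_analyticSha)
    (hGZK : rank_eq_analyticRank_of_analyticRank_le_one) (hmod : hasEntireLFunction_rat)
    (W : WeierstrassCurve ℚ) [W.IsElliptic] [W.IsGloballyMinimal] [Fact (3 : ℕ).Prime]
    {κ : ZpExtension ℚ 3} {γ : Field.absoluteGaloisGroup ℚ} {N : ℕ} [NeZero N]
    {f : CuspForm (Gamma0 N) 2} (hr : W.analyticRank ≤ 1) (hX : ClassX11 W 3) (hρ : Surj W 3)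
    (hns : ¬ W.HasSplitMultiplicativeReductionAtPrime 3)
    {q : ℚ_[3]} (hq0 : q ≠ 0) (hq1 : ‖q‖ < 1) (hqj : tateJ q = (W.j : ℚ_[3]))
    (hκ : κ.IsCyclotomic) (hγ : κ.IsTopGenerator γ) (hγ' : IsCyclotomicVariable 3 γ)
    (hf : IsNewformOf W f) (D : W.SelmerDualData κ γ) (ϖ : ℚ) (hϖ0 : ϖ ≠ 0)
    (hϖ : (ϖ : ℝ) * W.realPeriodRat = plusPeriod f)
    (L : PowerSeries ℚ_[3]) (hL : IsMultPAdicLFunctionOf f 3 (-1) L)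
    (hordL : L.order = (W.mordellWeilRank : ℕ))
    (hcert : ∀ Dh : PAdicHeightData W 3, IsMultCanonical Dh q →
      (((ϖ : ℚ) : ℚ_[3]) * PowerSeries.coeff W.mordellWeilRank L *
          (padicLog 3 (cyclotomicGenerator 3) ^ W.mordellWeilRank *
            (W.torsionOrder : ℚ_[3]) ^ 2)).valuation =
        (2 * (W.tamagawaProduct : ℚ_[3]) * padicRegulator Dh).valuation)
    {s : ℚ} (hs : shaAn W = (s : ℂ)) (hv : padicValRat 3 s = 0) : BSDp W 3 :=
  X11.bsdp_of_katoSurj_nonsplit_of_surjective_pow_of_certificate hK hJ hH hW hGZK hmod W 3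
    (by decide) hr hX (surjective_pow_three_of_mult h20 W hX.1 hρ) hns hq0 hq1 hqj hκ hγ hγ' hf D ϖ
    hϖ0 hϖ L hL hordL hcert hs hv

/-! ### The class's typed input holds at every pair where `BSD(E,3)` is obtained -/

/-- **Per-pair bookkeeping for R6.2.** If `BSD(E,3)` (`BSDp W 3`, Miller's Def. 1.1) holds for a
curve with `ord_{s=1} L(E,s) ≤ 1` — e.g. by `X11Three.bsdp_of_katoSurj_{split,nonsplit}_of_certificate`
above, by the exact-`3`-descent route `X11.bsdp_of_shaAn_unit_of_noPTorsion`, or by Miller's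
`N < 5000` theorem — then the CLASS's typed missing input `X11Three.MissingInputAt W`
(= "A′-locus ⇒ `PPart W 3`") holds at that pair: `BSDp ⇒ MissingPPartAt` (`missingPPartAt_of_bsdp`,
`Ш` finite by GZK) `⇒ PPart` (`pPart_of_missingPPartAt`, `L^{(r)}(E,1) ≠ 0` by modularity). The
typed `Prop` is a statement about the CLASS (any conductor); this lemma only records that a
certified pair is no counter-instance to it. [cite: Miller2011LMS, §1 and Def. 1.1 (arXiv:1010.2431 p. 3)] -/
theorem X11Three.missingInputAt_of_bsdp (hmod : hasEntireLFunction_rat)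
    (hGZK : rank_eq_analyticRank_of_analyticRank_le_one)
    (W : WeierstrassCurve ℚ) [W.IsElliptic] [W.IsGloballyMinimal] [Fact (3 : ℕ).Prime]
    (hr : W.analyticRank ≤ 1) (h : BSDp W 3) : X11Three.MissingInputAt W := by
  haveI : Finite W.sha := (hGZK W hr).2
  exact fun _ => pPart_of_missingPPartAt (W.leadingLCoeff_ne_zero_holds (hmod W))
    (missingPPartAt_of_bsdp W 3 h)

end Literature.NumberTheory.EllipticCurves.Rank1Residual.Typed

end
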